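import Mathlib.Topology.EMetricSpace.BoundedVariation
import Mathlib.Topology.MetricSpace.Pseudo.Lemmas
import Mathlib.Topology.UniformSpace.HeineCantor
import HarnessLib

/-!
# A locally Lipschitz function of a continuous path of bounded variation has bounded variation

Topic `Literature/Analysis/FunctionSpaces`.  Mathlib has `LipschitzOnWith.comp_eVariationOn_le`
(`V(F ∘ γ) ≤ C · V(γ)` when `F` is `C`-Lipschitz on the image).  For general position in
Schramm–Smirnov's Theorem 1.7 (level sets of `F ∘ γ` for `F` a coordinate of the inverse of a
conformal chart — locally but not globally Lipschitz on a Jordan domain with fjords) the local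
version is needed: **if `γ : [a, b] → E` is continuous of bounded variation with image in an open
set on which `F` is locally Lipschitz, then `F ∘ γ` has bounded variation on `[a, b]`**
(`boundedVariationOn_comp_of_locallyLipschitzOn`).  Proof: on the compact image, local Lipschitz
constants are uniform below a Lebesgue number `η` (`exists_forall_dist_lt_edist_le_of_isCompact`);
cut `[a, b]` into finitely many pieces on which `γ` oscillates less than `η`
(uniform continuity), apply Mathlib's lemma on each piece and add up (`eVariationOn.sum'`).

## References

* H. Federer, *Geometric Measure Theory* (1969), 2.10 (functions of bounded variation under
  Lipschitz maps). [Federer1969]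
* O. Schramm, S. Smirnov, Ann. Probab. 39 (2011), §2 (the use: "`α` has finite length and so for
  almost every `ε` …"). [SchrammSmirnov2011]
-/

noncomputable section

open Set Metric Filter Topology
open scoped ENNReal NNReal

namespace Literature.Analysis.FunctionSpaces

variable {E F : Type*} [PseudoMetricSpace E] [PseudoEMetricSpace F]

/-- **Uniform local Lipschitz bound on a compact set.**  If `F` is locally Lipschitz near every
point of an open set `O ⊇ K`, `K` compact, then for some `η > 0` and `M`, any two points of `K`
at distance `< η` satisfy `edist (F y) (F z) ≤ M · edist y z`. [folklore] -/
theorem exists_forall_dist_lt_edist_le_of_isCompact {f : E → F} {K O : Set E} (hK : IsCompact K)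
    (hKO : K ⊆ O) (hf : ∀ x ∈ O, ∃ C : ℝ≥0, ∃ t ∈ 𝓝 x, LipschitzOnWith C f t) :
    ∃ η > 0, ∃ M : ℝ≥0, ∀ y ∈ K, ∀ z ∈ K, dist y z < η → edist (f y) (f z) ≤ M * edist y z := by
  classical
  -- open balls on which `f` is Lipschitz
  have hball : ∀ x ∈ K, ∃ r > 0, ∃ C : ℝ≥0, LipschitzOnWith C f (ball x r) := by
    intro x hx
    obtain ⟨C, t, ht, hC⟩ := hf x (hKO hx)
    obtain ⟨r, hr, hrt⟩ := Metric.mem_nhds_iff.1 ht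
    exact ⟨r, hr, C, hC.mono hrt⟩
  choose! r hr C hC using hball
  obtain ⟨T, hTK, hcov⟩ := hK.elim_nhds_subcover (fun x => ball x (r x)) fun x hx =>
    ball_mem_nhds x (hr x hx)
  -- a Lebesgue number of the finite cover
  obtain ⟨η, hη, hleb⟩ := lebesgue_number_lemma_of_metric (ι := T) (c := fun x => ball (x : E) (r x))
    hK (fun _ => isOpen_ball) (by
      intro y hy
      have := hcov hy
      simp only [mem_iUnion, exists_prop] at this
      obtain ⟨x, hxT, hyx⟩ := this
      exact mem_iUnion.2 ⟨⟨x, hxT⟩, hyx⟩)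
  refine ⟨η, hη, T.sup C, fun y hy z hz hyz => ?_⟩
  obtain ⟨⟨x, hxT⟩, hx⟩ := hleb y hy
  have hyb : y ∈ ball x (r x) := hx (mem_ball_self hη)
  have hzb : z ∈ ball x (r x) := hx (by rw [mem_ball, dist_comm]; exact hyz)
  calc edist (f y) (f z) ≤ C x * edist y z := hC x (hTK x hxT) hyb hzb
    _ ≤ (T.sup C : ℝ≥0) * edist y z := by
        gcongr
        exact_mod_cast Finset.le_sup (f := C) hxT

/-- **`V(F ∘ γ; [a, b]) ≤ M · V(γ; [a, b])`** for `γ` continuous on `[a, b]` with image in an open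
set `O` (any set with `F` Lipschitz near each of its points; openness is not needed here) —
`M` from the uniform local bound on the image.
[cite: Federer1969, 2.10] -/
theorem exists_eVariationOn_comp_le_of_locallyLipschitzOn {f : E → F} {γ : ℝ → E} {a b : ℝ}
    {O : Set E} (hγ : ContinuousOn γ (Icc a b)) (hγO : MapsTo γ (Icc a b) O)
    (hf : ∀ x ∈ O, ∃ C : ℝ≥0, ∃ t ∈ 𝓝 x, LipschitzOnWith C f t) :
    ∃ M : ℝ≥0, eVariationOn (f ∘ γ) (Icc a b) ≤ M * eVariationOn γ (Icc a b) := by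
  rcases lt_or_ge b a with hab | hab
  · refine ⟨0, ?_⟩
    rw [eVariationOn.subsingleton _ (by rw [Icc_eq_empty_of_lt hab]; exact subsingleton_empty)]
    exact bot_le
  have hKc : IsCompact (γ '' Icc a b) := isCompact_Icc.image_of_continuousOn hγ
  obtain ⟨η, hη, M, hM⟩ := exists_forall_dist_lt_edist_le_of_isCompact hKc
    (image_subset_iff.2 hγO) hf
  -- uniform continuity of `γ`
  have hIc : IsCompact (Icc a b) := isCompact_Icc
  obtain ⟨θ, hθ, hγθ⟩ := Metric.uniformContinuousOn_iff.1 (hIc.uniformContinuousOn_of_continuous hγ) η hη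
  -- cut `[a, b]` into `N` pieces of length `< θ`
  obtain ⟨N, hN⟩ := exists_nat_gt ((b - a) / θ)
  have hNpos : 0 < N := by
    have : (0 : ℝ) < N := lt_of_le_of_lt (div_nonneg (by linarith) hθ.le) hN
    exact_mod_cast this
  set c : ℕ → ℝ := fun i => a + i * ((b - a) / N) with hc
  have hcmono : Monotone c := fun i j hij => by
    simp only [hc]
    have : (i : ℝ) * ((b - a) / N) ≤ j * ((b - a) / N) :=
      mul_le_mul_of_nonneg_right (by exact_mod_cast hij) (div_nonneg (by linarith) (by positivity))
    linarith
  have hc0 : c 0 = a := by simp [hc]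
  have hcN : c N = b := by simp only [hc]; field_simp; ring
  have hmesh : ∀ i, c (i + 1) - c i < θ := fun i => by
    simp only [hc]; push_cast
    have h1 : (b - a) / N < θ := by
      rw [div_lt_iff₀ (by exact_mod_cast hNpos)]
      calc b - a = (b - a) / θ * θ := by field_simp
        _ < N * θ := mul_lt_mul_of_pos_right hN hθ
        _ = θ * N := mul_comm _ _
    linarith [show (↑i + 1) * ((b - a) / ↑N) - ↑i * ((b - a) / ↑N) = (b - a) / N by ring]
  have hcmem : ∀ i ≤ N, c i ∈ Icc a b := fun i hi =>
    ⟨by rw [← hc0]; exact hcmono (Nat.zero_le i), by rw [← hcN]; exact hcmono hi⟩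
  -- on each piece `f` is `M`-Lipschitz on the image
  have hpiece : ∀ i < N, eVariationOn (f ∘ γ) (Icc (c i) (c (i + 1))) ≤
      M * eVariationOn γ (Icc (c i) (c (i + 1))) := by
    intro i hi
    have hsub : Icc (c i) (c (i + 1)) ⊆ Icc a b :=
      Icc_subset_Icc (hcmem i hi.le).1 (hcmem (i + 1) hi).2
    refine LipschitzOnWith.comp_eVariationOn_le (t := γ '' Icc (c i) (c (i + 1))) ?_ (mapsTo_image _ _)
    rintro _ ⟨u, hu, rfl⟩ _ ⟨v, hv, rfl⟩
    refine hM _ (mem_image_of_mem γ (hsub hu)) _ (mem_image_of_mem γ (hsub hv)) (hγθ u (hsub hu) v (hsub hv) ?_)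
    rw [Real.dist_eq, abs_lt]
    constructor <;> linarith [hu.1, hu.2, hv.1, hv.2, hmesh i]
  refine ⟨M, ?_⟩
  calc eVariationOn (f ∘ γ) (Icc a b) = eVariationOn (f ∘ γ) (Icc (c 0) (c N)) := by rw [hc0, hcN]
    _ = ∑ i ∈ Finset.range N, eVariationOn (f ∘ γ) (Icc (c i) (c (i + 1))) :=
        (eVariationOn.sum' _ hcmono).symm
    _ ≤ ∑ i ∈ Finset.range N, M * eVariationOn γ (Icc (c i) (c (i + 1))) :=
        Finset.sum_le_sum fun i hi => hpiece i (Finset.mem_range.1 hi)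
    _ = M * eVariationOn γ (Icc (c 0) (c N)) := by
        rw [← Finset.mul_sum, eVariationOn.sum' _ hcmono]
    _ = M * eVariationOn γ (Icc a b) := by rw [hc0, hcN]

/-- **A locally Lipschitz function of a continuous path of bounded variation has bounded
variation.** [cite: Federer1969, 2.10] -/
theorem boundedVariationOn_comp_of_locallyLipschitzOn {f : E → F} {γ : ℝ → E} {a b : ℝ}
    {O : Set E} (hγ : ContinuousOn γ (Icc a b)) (hγO : MapsTo γ (Icc a b) O)
    (hf : ∀ x ∈ O, ∃ C : ℝ≥0, ∃ t ∈ 𝓝 x, LipschitzOnWith C f t)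
    (hbv : BoundedVariationOn γ (Icc a b)) : BoundedVariationOn (f ∘ γ) (Icc a b) := by
  obtain ⟨M, hM⟩ := exists_eVariationOn_comp_le_of_locallyLipschitzOn hγ hγO hf
  exact ne_top_of_le_ne_top (ENNReal.mul_ne_top ENNReal.coe_ne_top hbv) hM

/-- The hypothesis in `LocallyLipschitzOn` form. [folklore] -/
theorem boundedVariationOn_comp_of_locallyLipschitzOn' {f : E → F} {γ : ℝ → E} {a b : ℝ}
    {O : Set E} (hO : IsOpen O) (hγ : ContinuousOn γ (Icc a b)) (hγO : MapsTo γ (Icc a b) O)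
    (hf : LocallyLipschitzOn O f) (hbv : BoundedVariationOn γ (Icc a b)) :
    BoundedVariationOn (f ∘ γ) (Icc a b) := by
  refine boundedVariationOn_comp_of_locallyLipschitzOn hγ hγO (fun x hx => ?_) hbv
  obtain ⟨C, t, ht, hC⟩ := hf hx
  exact ⟨C, t, (nhdsWithin_eq_nhds.2 (hO.mem_nhds hx)) ▸ ht, hC⟩

end Literature.Analysis.FunctionSpaces

end
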